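import Mathlib
import Summits.ValiantsHypothesis.ValiantsHypothesis.Theses.ValuativeGCT
import Summits.ValiantsHypothesis.ValiantsHypothesis.Theorems.ValuativeGCTValuativeFlipInnerMonotone
import Summits.ValiantsHypothesis.ValiantsHypothesis.Theorems.ValuativeGCTValuativeFlipTailSuffices

/-!
# `ValuativeGCT.ValuativeFlip` (stmt-ValiantsHypothesis-12624): inner sizes powers of two suffice —
# size-transfer axis, part IV b

Wall-breaker k12/16 (axis "representation-stability transfer between sizes"), seat 4, 2026-08-16; sibling
of `…ValuativeFlipSparseInnerSizes` (window-syndetic sets of inner sizes suffice, with a change of the window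
exponent).  For the set of powers of two NO change of exponent is needed, because `log₂ 2^k = k` and
`W_c(n) = 2^((log₂ n + c)^c)` only sees `log₂ n`: a position `(n, m)` of the window of `n` is a position of
the window of `2^(log₂ n) ≤ n` with the SAME exponent, and the flip body moves up from `2^(log₂ n)` to `n` by
inner monotonicity (`orbitMultiplicity_paddedPer_mono_inner`, part I).  Combined with k16's
`valuativeFlip_iff_polyPadded` (only polynomially padded positions matter):

* `valuativeFlip_iff_powTwo_polyPadded a (1 ≤ a)` — `ValuativeFlip` holds iff for every `c`, for all large
  `k`, EVERY matrix size `2^(a k) ≤ m ≤ 2^((k + c)^c)` carries a valuative flip of `X₀₀^(m - 2^k) per_(2^k)`;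
* `valuativeFlip_iff_powTwo` — the case `a = 1`: inner sizes `2^k`, all `2^k ≤ m ≤ 2^((k + c)^c)`.

So the crux is a statement about the padded permanents `X₀₀^(m - 2^k) per_(2^k)` alone, at paddings
`m ≥ 2^(a k)` of any fixed polynomial order, in the clean window `m ≤ 2^((k + c)^c)`.  Pure logic over part I
and `…TailSuffices`. [this crux; elementary]
-/

set_option linter.dupNamespace false

namespace Summit.ValiantsHypothesis.ValiantsHypothesis.Theorems.ValuativeFlip

open scoped BigOperators Matrix
open MvPolynomial
open Literature.NumberTheory.DiophantineGeometry
open Literature.Computability.AlgebraicComplexity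
open Summit.ValiantsHypothesis.ValiantsHypothesis.Theses.ValuativeGCT

noncomputable section

/-- **Sharpest normal form on this axis: inner sizes powers of two, padding at least polynomial, same
exponent.**  For every fixed `a ≥ 1`, `ValuativeFlip` holds iff for every `c`, for all large `k`, every
matrix size `m` with `2^(a k) ≤ m ≤ 2^((k + c)^c)` carries a valuative flip of `X₀₀^(m - 2^k) per_(2^k)`.
`→`: through `valuativeFlip_iff_polyPadded a` at `n = 2^k` (`log₂ 2^k = k`, `(2^k)^a = 2^(a k)`).
`←`: a position `(n, m)` with `n^a ≤ m ≤ W_c(n)` is reached from `(2^k, m)`, `k = log₂ n`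
(`2^(a k) ≤ n^a ≤ m`, and `W_c(n) = 2^((k + c)^c)` on the nose), by `flipBody_mono_inner`; positions with
`m < n^a` carry no logical weight (`valuativeFlip_iff_polyPadded`). [this file] -/
theorem valuativeFlip_iff_powTwo_polyPadded (a : ℕ) (ha : 1 ≤ a) :
    ValuativeFlip ↔ ∀ c : ℕ, ∃ k₀ : ℕ, ∀ k ≥ k₀, ∀ (m : ℕ) [NeZero m], 2 ^ (a * k) ≤ m → m ≤ 2 ^ ((k + c) ^ c) →
    ∃ (U : Submodule ℂ (MatIdx m → ℂ)) (r δ : ℕ) (lam : Nat.Partition (m * δ)),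
          (∀ u ∈ U, (Matrix.of fun a b : Fin m => u (toLex (a, b))).rank ≤ r) ∧ lam.parts.card ≤ m * m ∧
            Module.finrank ℂ ↥(MvPolynomial.homogeneousSubmodule (MatIdx m × MatIdx m) ℂ (m * δ) ⊓
                ((MvPolynomial.vanishingIdeal ℂ
                    {p : MatIdx m × MatIdx m → ℂ | ∀ j : MatIdx m, (fun i => p (j, i)) ∈ U}) ^ (δ * (m - r))).restrictScalars ℂ ⊓
                (⨅ (M : Matrix (MatIdx m) (MatIdx m) ℂ)
                  (_ : linSubst (MatIdx m) ℂ M (detFormLex ℂ m) = detFormLex ℂ m),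
                  LinearMap.ker ((MvPolynomial.aeval fun p : MatIdx m × MatIdx m =>
                      ∑ l : MatIdx m, M l p.2 •
                        (MvPolynomial.X (p.1, l) : MvPolynomial (MatIdx m × MatIdx m) ℂ)).toLinearMap -
                    (LinearMap.id : MvPolynomial (MatIdx m × MatIdx m) ℂ →ₗ[ℂ] MvPolynomial (MatIdx m × MatIdx m) ℂ))) ⊓
                (⨅ (g : Matrix.GeneralLinearGroup (MatIdx m) ℂ) (_ : IsUpperTriangular g),
                  LinearMap.ker ((MvPolynomial.aeval fun p : MatIdx m × MatIdx m =>
                      ∑ l : MatIdx m, ((g⁻¹ : Matrix.GeneralLinearGroup (MatIdx m) ℂ) :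
                        Matrix (MatIdx m) (MatIdx m) ℂ) p.1 l •
                          (MvPolynomial.X (l, p.2) : MvPolynomial (MatIdx m × MatIdx m) ℂ)).toLinearMap -
                    weightChar ((Weight.dualOfPartition (m * m) lam).toMatIdx : Weight (MatIdx m)) g •
                      (LinearMap.id : MvPolynomial (MatIdx m × MatIdx m) ℂ →ₗ[ℂ] MvPolynomial (MatIdx m × MatIdx m) ℂ)))) <
              orbitMultiplicity ℂ (paddedPerFormLex ℂ (2 ^ k) m) m
                ((Weight.dualOfPartition (m * m) lam).toMatIdx : Weight (MatIdx m)) := by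
  rw [valuativeFlip_iff_polyPadded a ha]
  constructor
  · intro H c
    obtain ⟨n₀, hn₀⟩ := H c
    refine ⟨n₀, fun k hk m _ hkm hm => ?_⟩
    have hk₀ : n₀ ≤ 2 ^ k := hk.trans (Nat.lt_two_pow_self).le
    have h1 : (2 ^ k) ^ a ≤ m := by rwa [← pow_mul, mul_comm]
    have h2 : m ≤ 2 ^ ((Nat.log 2 (2 ^ k) + c) ^ c) := by rwa [Nat.log_pow (by norm_num)]
    exact hn₀ (2 ^ k) hk₀ m h1 h2
  · intro H c
    obtain ⟨k₀, hk₀⟩ := H c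
    refine ⟨2 ^ k₀, fun n hn m _ hnm hm => ?_⟩
    have hn0 : n ≠ 0 := by
      have : 0 < 2 ^ k₀ := Nat.two_pow_pos k₀
      omega
    -- the inner size `2^k`, `k = log₂ n`
    have hk : k₀ ≤ Nat.log 2 n := Nat.le_log_of_pow_le (by norm_num) hn
    have hsn : 2 ^ Nat.log 2 n ≤ n := Nat.pow_log_le_self 2 hn0
    have h1 : 2 ^ (a * Nat.log 2 n) ≤ m := by
      rw [mul_comm, pow_mul]
      exact (Nat.pow_le_pow_left hsn a).trans hnm
    have hnm' : n ≤ m := by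
      refine le_trans ?_ hnm
      calc n = n ^ 1 := (pow_one n).symm
        _ ≤ n ^ a := Nat.pow_le_pow_right (Nat.pos_of_ne_zero hn0) ha
    obtain ⟨U, r, δ, lam, hU, hcard, hlt⟩ := hk₀ (Nat.log 2 n) hk m h1 hm
    exact ⟨U, r, δ, lam, hU, hcard,
      lt_of_lt_of_le hlt (orbitMultiplicity_paddedPer_mono_inner hsn hnm' _)⟩

/-- **Inner sizes powers of two suffice** (`a = 1` of `valuativeFlip_iff_powTwo_polyPadded`): `ValuativeFlip`
holds iff for every `c`, for all large `k`, every `2^k ≤ m ≤ 2^((k + c)^c)` carries a valuative flip of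
`X₀₀^(m - 2^k) per_(2^k)`. [this file] -/
theorem valuativeFlip_iff_powTwo :
    ValuativeFlip ↔ ∀ c : ℕ, ∃ k₀ : ℕ, ∀ k ≥ k₀, ∀ (m : ℕ) [NeZero m], 2 ^ k ≤ m → m ≤ 2 ^ ((k + c) ^ c) →
    ∃ (U : Submodule ℂ (MatIdx m → ℂ)) (r δ : ℕ) (lam : Nat.Partition (m * δ)),
          (∀ u ∈ U, (Matrix.of fun a b : Fin m => u (toLex (a, b))).rank ≤ r) ∧ lam.parts.card ≤ m * m ∧
            Module.finrank ℂ ↥(MvPolynomial.homogeneousSubmodule (MatIdx m × MatIdx m) ℂ (m * δ) ⊓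
                ((MvPolynomial.vanishingIdeal ℂ
                    {p : MatIdx m × MatIdx m → ℂ | ∀ j : MatIdx m, (fun i => p (j, i)) ∈ U}) ^ (δ * (m - r))).restrictScalars ℂ ⊓
                (⨅ (M : Matrix (MatIdx m) (MatIdx m) ℂ)
                  (_ : linSubst (MatIdx m) ℂ M (detFormLex ℂ m) = detFormLex ℂ m),
                  LinearMap.ker ((MvPolynomial.aeval fun p : MatIdx m × MatIdx m =>
                      ∑ l : MatIdx m, M l p.2 •
                        (MvPolynomial.X (p.1, l) : MvPolynomial (MatIdx m × MatIdx m) ℂ)).toLinearMap -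
                    (LinearMap.id : MvPolynomial (MatIdx m × MatIdx m) ℂ →ₗ[ℂ] MvPolynomial (MatIdx m × MatIdx m) ℂ))) ⊓
                (⨅ (g : Matrix.GeneralLinearGroup (MatIdx m) ℂ) (_ : IsUpperTriangular g),
                  LinearMap.ker ((MvPolynomial.aeval fun p : MatIdx m × MatIdx m =>
                      ∑ l : MatIdx m, ((g⁻¹ : Matrix.GeneralLinearGroup (MatIdx m) ℂ) :
                        Matrix (MatIdx m) (MatIdx m) ℂ) p.1 l •
                          (MvPolynomial.X (l, p.2) : MvPolynomial (MatIdx m × MatIdx m) ℂ)).toLinearMap -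
                    weightChar ((Weight.dualOfPartition (m * m) lam).toMatIdx : Weight (MatIdx m)) g •
                      (LinearMap.id : MvPolynomial (MatIdx m × MatIdx m) ℂ →ₗ[ℂ] MvPolynomial (MatIdx m × MatIdx m) ℂ)))) <
              orbitMultiplicity ℂ (paddedPerFormLex ℂ (2 ^ k) m) m
                ((Weight.dualOfPartition (m * m) lam).toMatIdx : Weight (MatIdx m)) := by
  rw [valuativeFlip_iff_powTwo_polyPadded 1 le_rfl]
  simp only [one_mul]

end

end Summit.ValiantsHypothesis.ValiantsHypothesis.Theorems.ValuativeFlip
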